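import Literature.Probability.RandomPlanarGeometry.CurveTortuosity
import Literature.Probability.RandomPlanarGeometry.VertexShellTraversals
import Literature.Probability.LatticeModels.LatticeInterface
import Literature.Probability.Percolation.InterfaceScalingLimitProofs
import HarnessLib

/-!
# Separate shell traversals of a polyline versus traversals by its vertex sequence

The dictionary between Aizenman–Burchard's event "the shell `D(x; r, R)` is traversed by `k`
separate segments" (`Curve.HasTraversals`, AB99 §1.b (1.3)) for a POLYLINE `polyline l`
(`Literature.Probability.LatticeModels.polyline`, the dyadic `Path.trans` parametrisation) and the
weak / separated VERTEX TRAVERSALS of its list of points `l` (written out explicitly, as in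
`VertexShellTraversals.lean`; no definitions are introduced):

* `exists_vertexTimes_polylineFrom` — the vertices are visited in order at strictly increasing
  times;
* `hasTraversals_polyline_of_sepVertexTraversals` — `k` separated vertex traversals give `k`
  separate traversals of the polyline;
* `exists_monotone_vertexIndex_polylineFrom` — a monotone assignment time ↦ vertex, `ε`-close to
  the curve when consecutive points are `ε`-close;
* `vertexTraversals_of_hasTraversals_polyline` — `k` separate traversals of `D(x; r, R)` by such a
  polyline give `k` weak vertex traversals of the shrunk shell `D(x; r + ε, R - ε)`.

Sources: M. Aizenman, A. Burchard, Duke Math. J. 99 (1999) §1.b and §3.a (discretisation of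
traversal counts); folklore. Deliberately NOT here: lattices, measures; no new definitions.
-/

open Set Metric
open scoped unitInterval

noncomputable section

namespace Literature.Probability.RandomPlanarGeometry

/-! ### The dyadic time structure of `polylineFrom` -/

section Polyline

open Literature.Probability.LatticeModels Literature.Probability.Percolation

variable {E : Type*} [NormedAddCommGroup E] [NormedSpace ℝ E]

omit [NormedSpace ℝ E] in
/-- The concatenation `γ.trans γ'` at the time `(s+1)/2` is `γ' s`. [folklore] -/
theorem path_trans_apply_halfR {a b c : E} (γ : Path a b) (γ' : Path b c) (s : I) :
    (γ.trans γ') (halfR s) = γ' s := by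
  rw [Path.trans_apply]
  split_ifs with h
  · -- `s = 0`: both sides are the junction point `b`
    have hs0 : (s : ℝ) = 0 := by
      have : ((s : ℝ) + 1) / 2 ≤ 1 / 2 := h
      linarith [s.2.1]
    have h1 : (⟨2 * ((halfR s : I) : ℝ), (unitInterval.mul_pos_mem_iff zero_lt_two).2
        ⟨(halfR s).2.1, h⟩⟩ : I) = 1 := Subtype.ext (by simp [hs0])
    rw [h1, γ.target, show s = 0 from Subtype.ext hs0, γ'.source]
  · congr 1
    exact Subtype.ext (by simp only [coe_halfR]; ring)

/-- **Vertex times.** The polyline `polylineFrom a l` visits the points of `a :: l` in order at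
STRICTLY increasing times `T 0 = 0 < T 1 < ⋯ < T (length l)` (`T j = 1 - 2^{-j}` in the dyadic
parametrisation; only monotonicity is recorded). [folklore] -/
theorem exists_vertexTimes_polylineFrom (a : E) (l : List E) :
    ∃ T : ℕ → I, (∀ i j, i < j → j ≤ l.length → T i < T j) ∧
      ∀ (j : ℕ) (hj : j < (a :: l).length), (polylineFrom a l).2 (T j) = (a :: l)[j] := by
  induction l generalizing a with
  | nil =>
    refine ⟨fun _ => 0, fun i j hij hj => by simp at hj; omega, fun j hj => ?_⟩
    have hj0 : j = 0 := by simp at hj; omega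
    subst hj0
    simpa using (polylineFrom a ([] : List E)).2.source
  | cons b l ih =>
    obtain ⟨T', hT'mono, hT'val⟩ := ih b
    refine ⟨fun j => if j = 0 then 0 else halfR (T' (j - 1)), fun i j hij hj => ?_, fun j hj => ?_⟩
    · have hj0 : j ≠ 0 := by omega
      dsimp only
      rw [if_neg hj0]
      by_cases hi0 : i = 0
      · rw [if_pos hi0]
        show ((0 : I) : ℝ) < ((halfR (T' (j - 1)) : I) : ℝ)
        simp only [Set.Icc.coe_zero, coe_halfR]
        linarith [(T' (j - 1)).2.1]
      · rw [if_neg hi0]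
        show ((halfR (T' (i - 1)) : I) : ℝ) < ((halfR (T' (j - 1)) : I) : ℝ)
        simp only [coe_halfR]
        have hlen : (b :: l).length = l.length + 1 := rfl
        have := hT'mono (i - 1) (j - 1) (by omega) (by rw [hlen] at hj; omega)
        have : ((T' (i - 1) : I) : ℝ) < (T' (j - 1) : I) := this
        linarith
    · rcases Nat.eq_zero_or_pos j with rfl | hjpos
      · simpa using (polylineFrom a (b :: l)).2.source
      · dsimp only
        rw [if_neg hjpos.ne', polylineFrom_cons]
        change ((Path.segment a b).trans (polylineFrom b l).2) (halfR (T' (j - 1))) = _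
        rw [path_trans_apply_halfR]
        have hj' : j - 1 < (b :: l).length := by
          simp only [List.length_cons] at hj ⊢; omega
        rw [hT'val (j - 1) hj']
        obtain ⟨j', rfl⟩ : ∃ j', j = j' + 1 := ⟨j - 1, by omega⟩
        simp

/-- **Separated vertex traversals give separate traversals of the polyline** (the vertices are
visited in order at strictly increasing times). [cite: AizenmanBurchard1999, §1.b (1.3)] -/
theorem hasTraversals_polyline_of_sepVertexTraversals {l : List E} {k : ℕ} {x : E} {r R : ℝ}
    (h : ∃ ι κ : Fin k → Fin l.length, (∀ m, ι m ≤ κ m) ∧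
      (∀ m, (dist (l.get (ι m)) x ≤ r ∧ R ≤ dist (l.get (κ m)) x) ∨
        (R ≤ dist (l.get (ι m)) x ∧ dist (l.get (κ m)) x ≤ r)) ∧ ∀ ⦃m m'⦄, m < m' → κ m < ι m') :
    (⟨polyline l⟩ : Curve E).HasTraversals k x r R := by
  obtain ⟨ι, κ, h1, h2, h3⟩ := h
  cases l with
  | nil =>
    -- no indices into the empty list: `k = 0`
    rcases Nat.eq_zero_or_pos k with rfl | hk
    · exact Curve.hasTraversals_zero _ _ _ _
    · exact (Nat.not_lt_zero _ (ι ⟨0, hk⟩).isLt).elim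
  | cons a l =>
    obtain ⟨T, hTmono, hTval⟩ := exists_vertexTimes_polylineFrom a l
    have hTle : ∀ i j : Fin (a :: l).length, i ≤ j → T i ≤ T j := by
      intro i j hij
      rcases hij.lt_or_eq with hlt | heq
      · exact (hTmono i j hlt (by have := j.isLt; simp at this; omega)).le
      · rw [show i = j from hij.antisymm (heq ▸ le_rfl)]
    have hval : ∀ i : Fin (a :: l).length,
        (⟨polyline (a :: l)⟩ : Curve E) (T i) = (a :: l).get i := fun i => by
      change (polylineFrom a l).2 (T i) = _
      rw [hTval i i.isLt, List.get_eq_getElem]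
    refine ⟨fun m => T (ι m), fun m => T (κ m), fun m => ⟨hTle _ _ (h1 m), ?_⟩, fun m m' hmm' =>
      hTmono _ _ (h3 hmm') (by have := (ι m').isLt; simp at this; omega)⟩
    rw [hval, hval]
    exact h2 m

/-- Points of the straight path `Path.segment a b` are within `dist a b` of `a`. [folklore] -/
theorem dist_path_segment_apply_le (a b : E) (s : I) : dist (Path.segment a b s) a ≤ dist a b := by
  have hmem : Path.segment a b s ∈ segment ℝ a b := by
    rw [← Path.range_segment a b]
    exact Set.mem_range_self s
  exact segment_subset_closedBall_left a b hmem

/-- **Location of the times on the vertices.** If consecutive points of `a :: l` are `ε`-close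
(`ε ≥ 0`), there is a MONOTONE assignment of a vertex index to every time such that the polyline
`polylineFrom a l` at time `t` is `ε`-close to the assigned vertex (the index of the segment
occupied at time `t`). [folklore] -/
theorem exists_monotone_vertexIndex_polylineFrom {ε : ℝ} (hε : 0 ≤ ε) (a : E) (l : List E)
    (hl : List.IsChain (fun p q => dist p q ≤ ε) (a :: l)) :
    ∃ idx : I → Fin (a :: l).length, Monotone idx ∧
      ∀ t, dist ((polylineFrom a l).2 t) ((a :: l).get (idx t)) ≤ ε := by
  induction l generalizing a with
  | nil =>
    refine ⟨fun _ => ⟨0, by simp⟩, fun _ _ _ => le_rfl, fun t => ?_⟩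
    change dist a a ≤ ε
    simpa using hε
  | cons b l ih =>
    have hab : dist a b ≤ ε := hl.rel
    obtain ⟨idx', hmono', hdist'⟩ := ih b hl.tail
    refine ⟨fun t => if h : (t : ℝ) ≤ 1 / 2 then ⟨0, by simp⟩ else
      (idx' ⟨2 * t - 1, unitInterval.two_mul_sub_one_mem_iff.2 ⟨(not_le.1 h).le, t.2.2⟩⟩).succ,
      fun t t' htt' => ?_, fun t => ?_⟩
    · have htt'' : (t : ℝ) ≤ t' := htt'
      dsimp only
      by_cases h : (t : ℝ) ≤ 1 / 2
      · rw [dif_pos h]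
        exact Fin.zero_le _
      · have h' : ¬ ((t' : ℝ) ≤ 1 / 2) := fun h' => h (htt''.trans h')
        rw [dif_neg h, dif_neg h']
        exact Fin.succ_le_succ_iff.2 (hmono' (show (2 * (t : ℝ) - 1) ≤ 2 * t' - 1 by linarith))
    · dsimp only
      by_cases h : (t : ℝ) ≤ 1 / 2
      · rw [dif_pos h]
        have hval : (polylineFrom a (b :: l)).2 t = Path.segment a b
            ⟨2 * t, (unitInterval.mul_pos_mem_iff zero_lt_two).2 ⟨unitInterval.nonneg t, h⟩⟩ := by
          change ((Path.segment a b).trans (polylineFrom b l).2) t = _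
          rw [Path.trans_apply, dif_pos h]
        rw [hval]
        exact (dist_path_segment_apply_le a b _).trans hab
      · rw [dif_neg h]
        have hval : (polylineFrom a (b :: l)).2 t = (polylineFrom b l).2
            ⟨2 * t - 1, unitInterval.two_mul_sub_one_mem_iff.2 ⟨(not_le.1 h).le, t.2.2⟩⟩ := by
          change ((Path.segment a b).trans (polylineFrom b l).2) t = _
          rw [Path.trans_apply, dif_neg h]
        rw [hval]
        simpa only [List.get_eq_getElem, Fin.val_succ, List.getElem_cons_succ] using hdist' _

/-- **Separate traversals of a polyline give weak vertex traversals of the shrunk shell.** If the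
polyline through `a :: l`, whose consecutive points are `ε`-close, traverses `D(x; r, R)` by `k`
separate segments, then its vertex sequence has `k` weak vertex traversals of
`D(x; r + ε, R - ε)`: replace each traversal time by a nearby vertex, monotonically.
[cite: AizenmanBurchard1999, §3.a (proof of Lemma 3.1)] -/
theorem vertexTraversals_of_hasTraversals_polyline {a : E} {l : List E} {ε : ℝ} (hε : 0 ≤ ε)
    (hl : List.IsChain (fun p q => dist p q ≤ ε) (a :: l)) {k : ℕ} {x : E} {r R : ℝ}
    (h : (⟨polyline (a :: l)⟩ : Curve E).HasTraversals k x r R) :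
    ∃ ι κ : Fin k → Fin (a :: l).length, (∀ m, ι m ≤ κ m) ∧
      (∀ m, (dist ((a :: l).get (ι m)) x ≤ r + ε ∧ R - ε ≤ dist ((a :: l).get (κ m)) x) ∨
        (R - ε ≤ dist ((a :: l).get (ι m)) x ∧ dist ((a :: l).get (κ m)) x ≤ r + ε)) ∧
      ∀ ⦃m m'⦄, m < m' → κ m ≤ ι m' := by
  obtain ⟨s, t, hst, hsep⟩ := h
  obtain ⟨idx, hmono, hdist⟩ := exists_monotone_vertexIndex_polylineFrom hε a l hl
  have hcurve : ∀ u, (⟨polyline (a :: l)⟩ : Curve E) u = (polylineFrom a l).2 u := fun u => rfl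
  have hnear : ∀ u, dist ((polylineFrom a l).2 u) x ≤ r →
      dist ((a :: l).get (idx u)) x ≤ r + ε := by
    intro u hu
    have h1 := dist_triangle ((a :: l).get (idx u)) ((polylineFrom a l).2 u) x
    have h2 := dist_comm ((polylineFrom a l).2 u) ((a :: l).get (idx u))
    linarith [hdist u]
  have hfar : ∀ u, R ≤ dist ((polylineFrom a l).2 u) x →
      R - ε ≤ dist ((a :: l).get (idx u)) x := by
    intro u hu
    have h1 := dist_triangle ((polylineFrom a l).2 u) ((a :: l).get (idx u)) x
    linarith [hdist u]
  refine ⟨fun m => idx (s m), fun m => idx (t m), fun m => hmono (hst m).1, fun m => ?_,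
    fun m m' hmm' => hmono (hsep hmm').le⟩
  have h2 := (hst m).2
  rw [hcurve, hcurve] at h2
  rcases h2 with h | h
  · exact Or.inl ⟨hnear _ h.1, hfar _ h.2⟩
  · exact Or.inr ⟨hfar _ h.1, hnear _ h.2⟩

/-- **From the vertex sequence of a glued walk to the arc through its middle piece (chordal
case).** If `l₁ ++ c ++ l₃` (`c ≠ []`) has `2k` weak vertex traversals of `D(x; r, R)`, `r < R`, no
point of `l₁`, `l₃` lies in `B̄(x, r)` and the end points of `c` are at distance `≥ R`, then the
polyline `m, c, m'` (any two extra end points) traverses `D(x; r, R)` by `k` separate segments.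
[cite: AizenmanBurchard1999, §3.a (proof of Lemma 3.1)] -/
theorem hasTraversals_polyline_middle {l₁ c l₃ : List E} (hc : c ≠ []) {k : ℕ} {x : E}
    {r R : ℝ} (hrR : r < R)
    (h : ∃ ι κ : Fin (2 * k) → Fin (l₁ ++ c ++ l₃).length, (∀ m, ι m ≤ κ m) ∧
      (∀ m, (dist ((l₁ ++ c ++ l₃).get (ι m)) x ≤ r ∧ R ≤ dist ((l₁ ++ c ++ l₃).get (κ m)) x) ∨
        (R ≤ dist ((l₁ ++ c ++ l₃).get (ι m)) x ∧ dist ((l₁ ++ c ++ l₃).get (κ m)) x ≤ r)) ∧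
      ∀ ⦃m m'⦄, m < m' → κ m ≤ ι m')
    (h₁ : ∀ p ∈ l₁, r < dist p x) (h₃ : ∀ p ∈ l₃, r < dist p x) (hhead : R ≤ dist (c.head hc) x)
    (hlast : R ≤ dist (c.getLast hc) x) (m m' : E) :
    (⟨polyline (m :: c ++ [m'])⟩ : Curve E).HasTraversals k x r R :=
  hasTraversals_polyline_of_sepVertexTraversals (sepVertexTraversals_of_two_mul
    (vertexTraversals_cons_append_singleton (vertexTraversals_middle hc h h₁ h₃ hhead hlast) m m')
    hrR)

/-- **From the vertex sequence of a glued walk to the arc through its final piece (rooted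
case).** If `l₁ ++ (c ++ [p])` has `2k` weak vertex traversals of `D(x; r, R)`, no point of `l₁`
lies in `B̄(x, r)`, the first point of `c ++ [p]` is at distance `≥ R`, and `m'` is `η`-close to
`p` with `r + η < R - η`, then the polyline `m, c, m'` traverses `D(x; r + η, R - η)` by `k`
separate segments. [cite: AizenmanBurchard1999, §3.a (proof of Lemma 3.1)] -/
theorem hasTraversals_polyline_final {l₁ c : List E} {p m' : E} {k : ℕ} {x : E} {r R η : ℝ}
    (hη : 0 ≤ η) (hrR : r + η < R - η) (hpm' : dist p m' ≤ η)
    (h : ∃ ι κ : Fin (2 * k) → Fin (l₁ ++ (c ++ [p])).length, (∀ m, ι m ≤ κ m) ∧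
      (∀ m, (dist ((l₁ ++ (c ++ [p])).get (ι m)) x ≤ r ∧ R ≤ dist ((l₁ ++ (c ++ [p])).get (κ m)) x) ∨
        (R ≤ dist ((l₁ ++ (c ++ [p])).get (ι m)) x ∧ dist ((l₁ ++ (c ++ [p])).get (κ m)) x ≤ r)) ∧
      ∀ ⦃m m'⦄, m < m' → κ m ≤ ι m')
    (h₁ : ∀ q ∈ l₁, r < dist q x) (hhead : R ≤ dist ((c ++ [p]).head (by simp)) x) (m : E) :
    (⟨polyline (m :: c ++ [m'])⟩ : Curve E).HasTraversals k x (r + η) (R - η) :=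
  hasTraversals_polyline_of_sepVertexTraversals (sepVertexTraversals_of_two_mul
    (vertexTraversals_cons (vertexTraversals_replace_last hη hpm'
      (vertexTraversals_of_append_left h h₁ (by simp) hhead)) m) hrR)

end Polyline

end Literature.Probability.RandomPlanarGeometry

end
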